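import Summits.BirchSwinnertonDyer.BirchSwinnertonDyer.Theorems.ManinLocalTwoThreeCubeStepPair
import Summits.BirchSwinnertonDyer.BirchSwinnertonDyer.Theorems.ManinLocalTwoThreeTwoShiftLaws
import HarnessLib

/-!
# The 2-adic twin, transfer step I: `SL(2, ℤ)` acting on `P¹(𝔽₂)` and the three subgroups of `Γ₀(M)`, `M` odd
# (route `ManinLocalTwoThree`, cell bsd-f2-manin; crux C2 `ManinOddAtFour` stmt-BirchSwinnertonDyer-22967; LEAD seat p1 gen 12;
# the «index-3 node» of p3's law G₂ `TwoShift.TwoShiftInvariantIsDiamond`, ask A-p3-1)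

The `p = 2` twin of p3's cube-step toolkit `…CubeTransfer.lean` / `…CubeStepPair.lean` (there `p = 3`, `P¹(𝔽₃)`, index `4`):
at a level `M` prime to `2` the two subgroups of the 2-shift step, `B = Γ₀(2M)` and `A = Γ₀(M) ∩ Γ⁰(2)`, are the stabilisers in
`G = Γ₀(M)` of the points `∞` and `0` of the projective line `P¹(𝔽₂)` (THREE points), on which `G` acts through `SL₂(𝔽₂) ≅ S₃`;
the index `[G : Stab 0] = 3` is odd, so the TRANSFER of p3's `…CubeTransfer.lean` §1 (`CubeStep.tr`, `CubeStep.transferSum`,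
`CubeStep.transferSum_mul` — abstract, imported as they are; likewise `CubeStep.exists_eq_g0Of`) will descend a 2-shift-(eigen-)invariant character from `Γ₀(2M)` to `Γ₀(M)`
(sibling files `…TwoShiftTransferPair.lean`, `…TwoShiftTransferStep.lean`).  Here:
* §1 the action of `SL(2, ℤ)` on `P¹(𝔽₂) = Option (ZMod 2)` (`none = ∞ = [1:0]`, `some j = [j:1]`) by reduction mod 2 (`act`,
  `act_one`, `act_mul`), the stabiliser criteria `act γ ∞ = ∞ ↔ 2 ∣ c`, `act γ 0 = 0 ↔ 2 ∣ b`, the kernel (`b ≡ c ≡ 0`), the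
  translations `act γ [u:1] = [u + bd : 1]` for `2 ∣ c`, the action of `g0Of` / `Tpow`;
* §2 the subgroups `stabInf M = Γ₀(2M)`, `stabZero M = Γ₀(M) ∩ Γ⁰(2)`, `kerAct M` of `Γ₀(M)` with their entrywise descriptions,
  and the Bezout element `δ` with `2δ + M² = 1` (`M` odd).
Vocabulary of the twin: p3's `…TwoShiftLaws.lean` (`TwoShift.IsAdd`, `IsShiftEigen`, `IsTwoShiftInvariant`, `RestrictsFrom`).
Nothing about BSD, Manin's conjecture, C2 or the laws G₂/G₈ is asserted here.  References: cell memo HOME/MEMO-es.md §37.9 (the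
`p = 3` original); the transfer: K. S. Brown, *Cohomology of Groups*, III.9 [cite: DarmonDiamondTaylor1995, Lemma 4.28 (p. 135) (shape:
degeneracy maps on `Γ₀`)].
-/

set_option autoImplicit false
set_option linter.dupNamespace false

open scoped MatrixGroups

open CongruenceSubgroup Matrix.SpecialLinearGroup
  Summit.BirchSwinnertonDyer.Rank1Residual.ManinAdditive.NineShiftEqualiser

namespace Summit.BirchSwinnertonDyer.BirchSwinnertonDyer.Theorems.ManinLocalTwoThree

namespace TwoShiftTransfer

/-! ### §1. `P¹(𝔽₂)` as `Option (ZMod 2)` and the action of `SL(2, ℤ)` -/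

section ProjectiveLine

/-- Homogeneous coordinates of a point of `P¹(𝔽₂)`: `∞ = none ↦ (1, 0)`, `some j ↦ (j, 1)`. [folklore] -/
def vec : Option (ZMod 2) → ZMod 2 × ZMod 2
  | none => (1, 0)
  | some j => (j, 1)

/-- The point of `P¹(𝔽₂)` with homogeneous coordinates `(u, v) ≠ (0, 0)` (`v⁻¹ = v` in `𝔽₂ˣ`). [folklore] -/
def label (u v : ZMod 2) : Option (ZMod 2) := if v = 0 then none else some (u * v)

/-- `label ∘ vec = id`. [folklore] -/
theorem label_vec (ℓ : Option (ZMod 2)) : label (vec ℓ).1 (vec ℓ).2 = ℓ := by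
  rcases ℓ with _ | j
  · simp [vec, label]
  · simp [vec, label]

/-- `vec ∘ label` rescales by a unit. [folklore] -/
theorem vec_label (u v : ZMod 2) (h : ¬(u = 0 ∧ v = 0)) :
    ∃ l : ZMod 2, l ≠ 0 ∧ vec (label u v) = (l * u, l * v) := by
  revert u v h
  decide

/-- `label` is invariant under rescaling by a unit. [folklore] -/
theorem label_smul (l u v : ZMod 2) (hl : l ≠ 0) : label (l * u) (l * v) = label u v := by
  revert l u v hl
  decide

/-- A matrix of determinant `1` over `𝔽₂` does not kill a nonzero vector. [folklore] -/
theorem apply_ne_zero (a b c d u v : ZMod 2) (hdet : a * d - b * c = 1) (h : ¬(u = 0 ∧ v = 0)) :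
    ¬(a * u + b * v = 0 ∧ c * u + d * v = 0) := by
  revert a b c d u v hdet h
  decide

/-- `vec ℓ ≠ 0`. [folklore] -/
theorem vec_ne_zero (ℓ : Option (ZMod 2)) : ¬((vec ℓ).1 = 0 ∧ (vec ℓ).2 = 0) := by
  rcases ℓ with _ | j <;> simp [vec]

/-- The mod-2 reduction of an entry of `γ ∈ SL(2, ℤ)`. [folklore] -/
abbrev ent (γ : SL(2, ℤ)) (i j : Fin 2) : ZMod 2 := ((γ i j : ℤ) : ZMod 2)

/-- `ent γ i j = 0 ↔ 2 ∣ γ i j`. [folklore] -/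
theorem ent_eq_zero_iff (γ : SL(2, ℤ)) (i j : Fin 2) : ent γ i j = 0 ↔ (2 : ℤ) ∣ (γ i j : ℤ) := by
  have h := ZMod.intCast_zmod_eq_zero_iff_dvd (γ i j : ℤ) 2
  exact_mod_cast h

/-- The determinant of `γ ∈ SL(2, ℤ)` mod 2. [folklore] -/
theorem det_ent (γ : SL(2, ℤ)) : ent γ 0 0 * ent γ 1 1 - ent γ 0 1 * ent γ 1 0 = 1 := by
  have h := Matrix.det_fin_two (γ : Matrix (Fin 2) (Fin 2) ℤ)
  rw [γ.2] at h
  have h' := congrArg (Int.cast : ℤ → ZMod 2) h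
  push_cast at h'
  simpa [ent] using h'.symm

/-- **The action of `SL(2, ℤ)` on `P¹(𝔽₂)`** (through reduction mod 2, on column vectors). [folklore] -/
def act (γ : SL(2, ℤ)) (ℓ : Option (ZMod 2)) : Option (ZMod 2) :=
  label (ent γ 0 0 * (vec ℓ).1 + ent γ 0 1 * (vec ℓ).2) (ent γ 1 0 * (vec ℓ).1 + ent γ 1 1 * (vec ℓ).2)

/-- `1` acts trivially. [folklore] -/
theorem act_one (ℓ : Option (ZMod 2)) : act 1 ℓ = ℓ := by
  simp [act, ent, label_vec]

/-- **`act` is an action**: `(γδ)·ℓ = γ·(δ·ℓ)`. [folklore] -/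
theorem act_mul (γ δ : SL(2, ℤ)) (ℓ : Option (ZMod 2)) : act (γ * δ) ℓ = act γ (act δ ℓ) := by
  set u := (vec ℓ).1 with hu
  set v := (vec ℓ).2 with hv
  set p := ent δ 0 0 * u + ent δ 0 1 * v with hp
  set q := ent δ 1 0 * u + ent δ 1 1 * v with hq
  have hpq : ¬(p = 0 ∧ q = 0) := apply_ne_zero _ _ _ _ u v (det_ent δ) (vec_ne_zero ℓ)
  obtain ⟨l, hl, hvl⟩ := vec_label p q hpq
  have hR : act γ (act δ ℓ) = label (ent γ 0 0 * p + ent γ 0 1 * q) (ent γ 1 0 * p + ent γ 1 1 * q) := by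
    rw [show act δ ℓ = label p q from rfl, act, hvl]
    dsimp only
    rw [show ent γ 0 0 * (l * p) + ent γ 0 1 * (l * q) = l * (ent γ 0 0 * p + ent γ 0 1 * q) by ring,
      show ent γ 1 0 * (l * p) + ent γ 1 1 * (l * q) = l * (ent γ 1 0 * p + ent γ 1 1 * q) by ring,
      label_smul _ _ _ hl]
  have hent : ∀ i j : Fin 2, ent (γ * δ) i j = ent γ i 0 * ent δ 0 j + ent γ i 1 * ent δ 1 j := by
    intro i j
    simp [ent, Matrix.SpecialLinearGroup.coe_mul, Matrix.mul_apply, Fin.sum_univ_two]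
  rw [hR, act, hent, hent, hent, hent]
  congr 1
  · rw [hp, hq]; ring
  · rw [hp, hq]; ring

/-- `γ⁻¹·(γ·ℓ) = ℓ`. [folklore] -/
theorem act_inv_act (γ : SL(2, ℤ)) (ℓ : Option (ZMod 2)) : act γ⁻¹ (act γ ℓ) = ℓ := by
  rw [← act_mul, inv_mul_cancel, act_one]

/-- `γ·ℓ` is injective in `ℓ`. [folklore] -/
theorem act_injective (γ : SL(2, ℤ)) : Function.Injective (act γ) := fun x y h => by
  simpa [act_inv_act] using congrArg (act γ⁻¹) h

/-- `γ·∞` in coordinates. [folklore] -/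
theorem act_none (γ : SL(2, ℤ)) : act γ none = label (ent γ 0 0) (ent γ 1 0) := by
  simp [act, vec]

/-- `γ·0` in coordinates. [folklore] -/
theorem act_some_zero (γ : SL(2, ℤ)) : act γ (some 0) = label (ent γ 0 1) (ent γ 1 1) := by
  simp [act, vec]

/-- **`B = Stab(∞)`**: `γ·∞ = ∞ ↔ 2 ∣ c`. [folklore] -/
theorem act_none_eq_none_iff (γ : SL(2, ℤ)) : act γ none = none ↔ (2 : ℤ) ∣ (γ 1 0 : ℤ) := by
  rw [act_none, label, ← ent_eq_zero_iff]
  constructor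
  · intro h
    by_contra hc
    rw [if_neg hc] at h
    exact Option.some_ne_none _ h
  · intro h
    simp [ent, h]

/-- Auxiliary: for `ad − bc = 1` in `𝔽₂`, `label b d = 0 ↔ b = 0`. [folklore] -/
theorem label_eq_some_zero_iff (a b c d : ZMod 2) (hdet : a * d - b * c = 1) : label b d = some 0 ↔ b = 0 := by
  revert a b c d hdet
  decide

/-- **`A = Stab(0)`**: `γ·0 = 0 ↔ 2 ∣ b`. [folklore] -/
theorem act_some_zero_eq_iff (γ : SL(2, ℤ)) : act γ (some 0) = some 0 ↔ (2 : ℤ) ∣ (γ 0 1 : ℤ) := by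
  rw [act_some_zero, label_eq_some_zero_iff _ _ _ _ (det_ent γ), ← ent_eq_zero_iff]

/-- Auxiliary: `ad = 1` in `𝔽₂` forces `d = a ≠ 0`. [folklore] -/
theorem eq_of_mul_eq_one (a d : ZMod 2) (h : a * d = 1) : d = a ∧ a ≠ 0 := by
  revert a d h
  decide

/-- **The kernel of the action**: `b ≡ c ≡ 0 (mod 2)` implies `γ` acts trivially (`γ ≡ I`). [folklore] -/
theorem act_eq_self (γ : SL(2, ℤ)) (hb : (2 : ℤ) ∣ (γ 0 1 : ℤ)) (hc : (2 : ℤ) ∣ (γ 1 0 : ℤ))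
    (ℓ : Option (ZMod 2)) : act γ ℓ = ℓ := by
  have hb' : ent γ 0 1 = 0 := (ent_eq_zero_iff γ 0 1).mpr hb
  have hc' : ent γ 1 0 = 0 := (ent_eq_zero_iff γ 1 0).mpr hc
  have hdet := det_ent γ
  rw [hb', hc', zero_mul, sub_zero] at hdet
  obtain ⟨hd, ha⟩ := eq_of_mul_eq_one _ _ hdet
  rw [act, hb', hc', hd, zero_mul, add_zero, zero_mul, zero_add, label_smul _ _ _ ha, label_vec]

/-- **Translations**: an element of `Stab(∞)` (`2 ∣ c`) acts on the affine line by `u ↦ u + b·d`. [folklore] -/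
theorem act_some_of_dvd (γ : SL(2, ℤ)) (hc : (2 : ℤ) ∣ (γ 1 0 : ℤ)) (u : ZMod 2) :
    act γ (some u) = some (u + ent γ 0 1 * ent γ 1 1) := by
  have hc' : ent γ 1 0 = 0 := (ent_eq_zero_iff γ 1 0).mpr hc
  have hdet := det_ent γ
  rw [hc', mul_zero, sub_zero] at hdet
  obtain ⟨_, ha⟩ := eq_of_mul_eq_one _ _ hdet
  have hd : ent γ 1 1 ≠ 0 := fun h => by rw [h, mul_zero] at hdet; exact zero_ne_one hdet
  simp only [act, vec, hc', zero_mul, zero_add, mul_one, label, if_neg hd]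
  congr 1
  linear_combination u * hdet

/-- An element fixing `∞` and `0` acts trivially. [folklore] -/
theorem act_eq_self_of_fix (γ : SL(2, ℤ)) (h1 : act γ none = none) (h2 : act γ (some 0) = some 0)
    (ℓ : Option (ZMod 2)) : act γ ℓ = ℓ :=
  act_eq_self γ ((act_some_zero_eq_iff γ).mp h2) ((act_none_eq_none_iff γ).mp h1) ℓ

/-- Every `γ` maps SOME finite point to a finite point. [folklore] -/
theorem exists_act_some_eq_some (γ : SL(2, ℤ)) : ∃ u v : ZMod 2, act γ (some u) = some v := by
  by_cases h : act γ (some 0) = none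
  · have h1 : act γ (some 1) ≠ none := fun h1 => by
      have := act_injective γ (h.trans h1.symm)
      exact absurd (Option.some_injective _ this) (by decide)
    obtain ⟨v, hv⟩ := Option.ne_none_iff_exists'.mp h1
    exact ⟨1, v, hv⟩
  · obtain ⟨v, hv⟩ := Option.ne_none_iff_exists'.mp h
    exact ⟨0, v, hv⟩

variable {M : ℕ}

/-- The action of an explicit matrix `g0Of a b c d ∈ Γ₀(M)`. [folklore] -/
theorem act_g0Of (a b c d : ℤ) (h : a * d - b * c = 1) (hc : (M : ℤ) ∣ c) (ℓ : Option (ZMod 2)) :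
    act ((g0Of a b c d h hc : Gamma0 M) : SL(2, ℤ)) ℓ =
      label ((a : ZMod 2) * (vec ℓ).1 + (b : ZMod 2) * (vec ℓ).2)
        ((c : ZMod 2) * (vec ℓ).1 + (d : ZMod 2) * (vec ℓ).2) := rfl

/-- `T^k` fixes `∞`. [folklore] -/
theorem act_Tpow_none (k : ℤ) : act ((ThreeShiftDescent.Tpow M k : Gamma0 M) : SL(2, ℤ)) none = none := by
  simp [ThreeShiftDescent.Tpow, act_g0Of, vec, label]

/-- `T^k` translates the affine line by `k`. [folklore] -/
theorem act_Tpow_some (k : ℤ) (u : ZMod 2) :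
    act ((ThreeShiftDescent.Tpow M k : Gamma0 M) : SL(2, ℤ)) (some u) = some (u + (k : ZMod 2)) := by
  simp [ThreeShiftDescent.Tpow, act_g0Of, vec, label]

end ProjectiveLine

/-! ### §2. The three subgroups of `Γ₀(M)` and their entries -/

section Subgroups

open ThreeShiftDescent

variable (M : ℕ)

/-- `Stab(∞) = {γ ∈ Γ₀(M) : 2 ∣ c} = Γ₀(2M)` (for `2 ∤ M`). [folklore] -/
def stabInf : Subgroup (Gamma0 M) where
  carrier := {γ | act (γ : SL(2, ℤ)) none = none}
  mul_mem' := by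
    intro x y hx hy
    simp only [Set.mem_setOf_eq, Subgroup.coe_mul, act_mul] at *
    rw [hy, hx]
  one_mem' := by simp [act_one]
  inv_mem' := by
    intro x hx
    simp only [Set.mem_setOf_eq, Subgroup.coe_inv] at *
    conv_lhs => rw [← hx]
    rw [act_inv_act]

/-- `Stab(0) = {γ ∈ Γ₀(M) : 2 ∣ b} = Γ₀(M) ∩ Γ⁰(2)`. [folklore] -/
def stabZero : Subgroup (Gamma0 M) where
  carrier := {γ | act (γ : SL(2, ℤ)) (some 0) = some 0}
  mul_mem' := by
    intro x y hx hy
    simp only [Set.mem_setOf_eq, Subgroup.coe_mul, act_mul] at *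
    rw [hy, hx]
  one_mem' := by simp [act_one]
  inv_mem' := by
    intro x hx
    simp only [Set.mem_setOf_eq, Subgroup.coe_inv] at *
    conv_lhs => rw [← hx]
    rw [act_inv_act]

/-- The kernel of the action on `P¹(𝔽₂)`: `{γ ∈ Γ₀(M) : γ ≡ I (mod 2)}`. [folklore] -/
def kerAct : Subgroup (Gamma0 M) where
  carrier := {γ | ∀ ℓ, act (γ : SL(2, ℤ)) ℓ = ℓ}
  mul_mem' := by
    intro x y hx hy ℓ
    simp only [Set.mem_setOf_eq] at hx hy
    rw [Subgroup.coe_mul, act_mul, hy, hx]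
  one_mem' := fun ℓ => by simp [act_one]
  inv_mem' := by
    intro x hx ℓ
    simp only [Set.mem_setOf_eq] at hx
    conv_lhs => rw [← hx ℓ]
    rw [Subgroup.coe_inv, act_inv_act]

variable {M}

/-- Membership in `stabInf`. [folklore] -/
theorem mem_stabInf {γ : Gamma0 M} : γ ∈ stabInf M ↔ act (γ : SL(2, ℤ)) none = none := Iff.rfl

/-- Membership in `stabZero`. [folklore] -/
theorem mem_stabZero {γ : Gamma0 M} : γ ∈ stabZero M ↔ act (γ : SL(2, ℤ)) (some 0) = some 0 := Iff.rfl

/-- Membership in `kerAct`. [folklore] -/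
theorem mem_kerAct {γ : Gamma0 M} : γ ∈ kerAct M ↔ ∀ ℓ, act (γ : SL(2, ℤ)) ℓ = ℓ := Iff.rfl

/-- `kerAct` by entries: `2 ∣ b` and `2 ∣ c`. [folklore] -/
theorem mem_kerAct_iff {γ : Gamma0 M} :
    γ ∈ kerAct M ↔ (2 : ℤ) ∣ ((γ : SL(2, ℤ)) 0 1 : ℤ) ∧ (2 : ℤ) ∣ ((γ : SL(2, ℤ)) 1 0 : ℤ) := by
  constructor
  · intro h
    exact ⟨(act_some_zero_eq_iff _).mp (h (some 0)), (act_none_eq_none_iff _).mp (h none)⟩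
  · rintro ⟨hb, hc⟩ ℓ
    exact act_eq_self _ hb hc ℓ

/-- `kerAct ≤ stabInf`. [folklore] -/
theorem stabInf_of_kerAct {γ : Gamma0 M} (h : γ ∈ kerAct M) : γ ∈ stabInf M := h none

/-- `kerAct ≤ stabZero`. [folklore] -/
theorem stabZero_of_kerAct {γ : Gamma0 M} (h : γ ∈ kerAct M) : γ ∈ stabZero M := h (some 0)

/-- `stabInf ∩ stabZero ≤ kerAct`. [folklore] -/
theorem kerAct_of_stab {γ : Gamma0 M} (h1 : γ ∈ stabInf M) (h2 : γ ∈ stabZero M) : γ ∈ kerAct M :=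
  fun ℓ => act_eq_self_of_fix _ h1 h2 ℓ

/-- `kerAct` is normal in `Γ₀(M)`. [folklore] -/
theorem kerAct_conj_mem (g : Gamma0 M) {x : Gamma0 M} (hx : x ∈ kerAct M) : g * x * g⁻¹ ∈ kerAct M := by
  intro ℓ
  rw [Subgroup.coe_mul, Subgroup.coe_mul, act_mul, act_mul, hx, ← act_mul, Subgroup.coe_inv, mul_inv_cancel,
    act_one]

/-- `kerAct` is normal in `Γ₀(M)` (conjugation the other way). [folklore] -/
theorem kerAct_inv_conj_mem (g : Gamma0 M) {x : Gamma0 M} (hx : x ∈ kerAct M) : g⁻¹ * x * g ∈ kerAct M := by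
  simpa using kerAct_conj_mem g⁻¹ hx

/-- **The Bezout element**: for `2 ∤ M` there is `δ` with `2δ + M² = 1`. [folklore] -/
theorem exists_delta (hM2 : ¬ 2 ∣ M) : ∃ δ : ℤ, 2 * δ + (M : ℤ) * M = 1 := by
  have h : M % 2 = 1 := by omega
  have hM : (M : ℤ) = 2 * (M / 2 : ℕ) + (M % 2 : ℕ) := by exact_mod_cast (Nat.div_add_mod M 2).symm
  exact ⟨-(2 * (M / 2 : ℕ) * (M / 2 : ℕ) + 2 * (M / 2 : ℕ)), by rw [hM, h]; push_cast; ring⟩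

/-- `2 ∣ c` and `M ∣ c` give `2M ∣ c` when `2 ∤ M`. [folklore] -/
theorem two_mul_dvd (hM2 : ¬ 2 ∣ M) {c : ℤ} (h2 : (2 : ℤ) ∣ c) (hM : (M : ℤ) ∣ c) : ((2 * M : ℕ) : ℤ) ∣ c := by
  obtain ⟨δ, hδ⟩ := exists_delta hM2
  have hcop : IsCoprime (2 : ℤ) (M : ℤ) := ⟨δ, M, by linear_combination hδ⟩
  push_cast
  exact hcop.mul_dvd h2 hM

/-- `stabInf` by entries: `2M ∣ c`. [folklore] -/
theorem mem_stabInf_iff (hM2 : ¬ 2 ∣ M) {γ : Gamma0 M} :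
    γ ∈ stabInf M ↔ ((2 * M : ℕ) : ℤ) ∣ ((γ : SL(2, ℤ)) 1 0 : ℤ) := by
  rw [mem_stabInf, act_none_eq_none_iff]
  constructor
  · intro h
    exact two_mul_dvd hM2 h ((ZMod.intCast_zmod_eq_zero_iff_dvd _ _).mp (Gamma0_mem.mp γ.2))
  · intro h
    exact (dvd_mul_right (2 : ℤ) (M : ℤ)).trans (by exact_mod_cast h)

/-- `stabZero` by entries: `2 ∣ b`. [folklore] -/
theorem mem_stabZero_iff {γ : Gamma0 M} : γ ∈ stabZero M ↔ (2 : ℤ) ∣ ((γ : SL(2, ℤ)) 0 1 : ℤ) := by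
  rw [mem_stabZero, act_some_zero_eq_iff]

/-- An element of `stabZero` is `(a, 2b; c, d)`. [folklore] -/
theorem exists_eq_of_mem_stabZero {x : Gamma0 M} (hx : x ∈ stabZero M) :
    ∃ (a b c d : ℤ) (h : a * d - (2 * b) * c = 1) (hc : (M : ℤ) ∣ c), x = g0Of a (2 * b) c d h hc := by
  obtain ⟨b, hb⟩ := mem_stabZero_iff.mp hx
  have hdet := gamma0_det_entries x
  rw [hb] at hdet
  refine ⟨_, b, _, _, hdet, ((ZMod.intCast_zmod_eq_zero_iff_dvd _ _).mp (Gamma0_mem.mp x.2)), ?_⟩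
  calc x = g0Of ((x : SL(2, ℤ)) 0 0) ((x : SL(2, ℤ)) 0 1) ((x : SL(2, ℤ)) 1 0) ((x : SL(2, ℤ)) 1 1)
        (gamma0_det_entries x) ((ZMod.intCast_zmod_eq_zero_iff_dvd _ _).mp (Gamma0_mem.mp x.2)) :=
      (g0Of_entries x (gamma0_det_entries x) ((ZMod.intCast_zmod_eq_zero_iff_dvd _ _).mp (Gamma0_mem.mp x.2))).symm
    _ = _ := g0Of_congr rfl hb rfl rfl _ _ _ _

/-- An element of `stabInf` is `(a, b; c, d)` with `2M ∣ c`. [folklore] -/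
theorem exists_eq_of_mem_stabInf (hM2 : ¬ 2 ∣ M) {x : Gamma0 M} (hx : x ∈ stabInf M) :
    ∃ (a b c d : ℤ) (h : a * d - b * c = 1) (hc : (M : ℤ) ∣ c),
      ((2 * M : ℕ) : ℤ) ∣ c ∧ x = g0Of a b c d h hc :=
  ⟨_, _, _, _, gamma0_det_entries x, ((ZMod.intCast_zmod_eq_zero_iff_dvd _ _).mp (Gamma0_mem.mp x.2)),
    (mem_stabInf_iff hM2).mp hx,
    (g0Of_entries x (gamma0_det_entries x) ((ZMod.intCast_zmod_eq_zero_iff_dvd _ _).mp (Gamma0_mem.mp x.2))).symm⟩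

/-- `g0Of a (2b) c d ∈ stabZero`. [folklore] -/
theorem g0Of_mem_stabZero (a b c d : ℤ) (h : a * d - (2 * b) * c = 1) (hc : (M : ℤ) ∣ c) :
    (g0Of a (2 * b) c d h hc : Gamma0 M) ∈ stabZero M :=
  mem_stabZero_iff.mpr ⟨b, rfl⟩

/-- `g0Of a b c d ∈ stabInf` when `2M ∣ c`. [folklore] -/
theorem g0Of_mem_stabInf (hM2 : ¬ 2 ∣ M) (a b c d : ℤ) (h : a * d - b * c = 1) (hc : (M : ℤ) ∣ c)
    (hc2 : ((2 * M : ℕ) : ℤ) ∣ c) : (g0Of a b c d h hc : Gamma0 M) ∈ stabInf M :=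
  (mem_stabInf_iff hM2).mpr hc2

/-- `T^k ∈ stabInf`. [folklore] -/
theorem Tpow_mem_stabInf (k : ℤ) : (Tpow M k : Gamma0 M) ∈ stabInf M := act_Tpow_none k

/-- `2M ∣ 2c` from `M ∣ c`. [folklore] -/
theorem dvd_two_mul' {c : ℤ} (hc : (M : ℤ) ∣ c) : ((2 * M : ℕ) : ℤ) ∣ 2 * c := by
  obtain ⟨k, hk⟩ := hc
  exact ⟨k, by rw [hk]; push_cast; ring⟩

end Subgroups

end TwoShiftTransfer

end Summit.BirchSwinnertonDyer.BirchSwinnertonDyer.Theorems.ManinLocalTwoThree
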